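import Literature.MathematicalPhysics.QuantumLattice.LTQOFrustrationFreeProofs
import Literature.MathematicalPhysics.QuantumLattice.LTQOProofs
import HarnessLib

/-!
# The local decomposition of a `P₀`-commuting perturbation term (MZ13 Lemma 4, algebraic part)

Top-down layer (seat B) of the formalisation of the Michalakis–Zwolak stability theorem
(hubbard.S19, `Literature.MathematicalPhysics.QuantumLattice.michalakis_zwolak`). Setting of
Michalakis–Zwolak, CMP **322** (2013) 277 = arXiv:1109.1588, §5.2 (steps 3–4, Lemmas 3–4): a
frustration-free projector interaction `Φ` on a finite site set with global ground-state
projection `P₀ = P_univ` and a chain of local ground-state projections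
`P_0 ≥ P_1 ≥ ⋯ ≥ P_N = P₀` (`P_j = localGroundProj Φ (B j)` for an increasing chain of regions
`B 0 ⊆ B 1 ⊆ ⋯` exhausting the lattice, e.g. the balls `cellBall u j`), and an observable `Y`
(the recentred term `X̃_u = X_u − c(X_u)`) commuting with `P₀`.

MZ13 write `X̃_u = W_u + Δ_u`, `W_u = (1 − P₀) X̃_u (1 − P₀)`, `Δ_u = P₀ X̃_u P₀`, and decompose
`W_u` into pieces annihilated by local ground states using the orthogonal resolution
`E_m = P_{b_u(m−1)} − P_{b_u(m)}` (arXiv:1109.1588 p. 13, "Define an orthogonal unity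
decomposition `𝟙 = Σ_m E_m` … `Y_u(j) P_{b_j(u)} = 0` and `Z_u(2q−1) P_{b_u(2q−1)} = 0`"). This file
proves the algebra of a **telescoping variant** of that decomposition, which produces pieces
with the same annihilation property and is easier to estimate: with `Q_j = 1 − P_j` and
`S_j = Q_j Y Q_j`,

* `Y = S_N + P₀ Y P₀` when `[Y, P₀] = 0` and `P_N = P₀` (`eq_sandwich_add_sandwich_of_commute`);
* `S_N = S_0 + Σ_{j<N} (S_{j+1} − S_j)` (telescoping);
* every piece is *locally block-off-diagonal*: `S_0 P_0 = 0 = P_0 S_0` and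
  `(S_{j+1} − S_j) P_{j+1} = 0 = P_{j+1} (S_{j+1} − S_j)` (because `Q_j P_{j+1} = 0` for nested
  projections) — the input format of the relative bound
  `norm_inner_sum_le_of_locallyAnnihilated` (MZ13 Proposition 2);
* `S_{j+1} − S_j = E Y Q_{j+1} + Q_j Y E` with `E = P_j − P_{j+1}`, whence
  `‖S_{j+1} − S_j‖ ≤ 2‖E Y‖` for Hermitian `Y`, and `‖E Y‖ ≤ ‖O P_j‖ + ‖Y − O‖` for any Hermitian
  `O` (to be taken supported near the centre, so that Local-TQO controls `‖O P_j‖`); and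
  `‖O P₀‖ ≤ ‖P₀ Y P₀‖ + ‖Y − O‖` when `[Y, P₀] = 0`.

Everything here is pure matrix algebra for Hermitian idempotents (no lattice geometry, no LTQO);
the LTQO norm estimates are in `StabilityLTQOEstimatesProofs` and the assembly per ball chain
follows in the next layer. No definitions, no named facts (theorems only).
-/

noncomputable section

open Matrix Finset Module
open scoped InnerProductSpace ComplexOrder Matrix.Norms.L2Operator

namespace Literature.MathematicalPhysics.QuantumLattice

open Literature.Probability.LatticeModels

/-! ### Nested orthogonal projections -/

section Projections

variable {n : Type*} [Fintype n] [DecidableEq n]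

omit [DecidableEq n] in
/-- For nested projections `P' P = P'` (range of `P'` inside range of `P`), also `P P' = P'`
(adjoints). [folklore] -/
theorem mul_eq_of_mul_eq_of_isHermitian {P P' : Matrix n n ℂ} (hP : P.IsHermitian)
    (hP' : P'.IsHermitian) (h : P' * P = P') : P * P' = P' := by
  have h1 := congrArg conjTranspose h
  rwa [conjTranspose_mul, hP.eq, hP'.eq] at h1

/-- `(1 − P) P' = 0` for nested projections `P P' = P'`. [folklore] -/
theorem one_sub_mul_eq_zero_of_mul_eq {P P' : Matrix n n ℂ} (h : P * P' = P') :
    (1 - P) * P' = 0 := by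
  rw [Matrix.sub_mul, Matrix.one_mul, h, sub_self]

/-- `P' (1 − P) = 0` for nested projections `P' P = P'`. [folklore] -/
theorem mul_one_sub_eq_zero_of_mul_eq {P P' : Matrix n n ℂ} (h : P' * P = P') :
    P' * (1 - P) = 0 := by
  rw [Matrix.mul_sub, Matrix.mul_one, h, sub_self]

/-- `1 − P` is idempotent when `P` is. [folklore] -/
theorem one_sub_mul_one_sub {P : Matrix n n ℂ} (h : P * P = P) : (1 - P) * (1 - P) = 1 - P := by
  rw [Matrix.sub_mul, Matrix.one_mul, isIdempotentElem_iff_mul_one_sub_self.mp h, sub_zero]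

omit [Fintype n] in
/-- `1 − P` is Hermitian when `P` is. [folklore] -/
theorem isHermitian_one_sub {P : Matrix n n ℂ} (hP : P.IsHermitian) : (1 - P).IsHermitian :=
  isHermitian_one.sub hP

omit [DecidableEq n] in
/-- The difference `E = P − P'` of nested projections (`P' P = P' = P P'`) is an idempotent:
`E² = E`. [folklore] -/
theorem sub_mul_sub_of_nested {P P' : Matrix n n ℂ} (hP2 : P * P = P) (hP'2 : P' * P' = P')
    (h₁ : P' * P = P') (h₂ : P * P' = P') : (P - P') * (P - P') = P - P' := by
  rw [Matrix.sub_mul, Matrix.mul_sub, Matrix.mul_sub, hP2, h₂, h₁, hP'2]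
  abel

/-- `E = P − P' = (1 − P') P` for nested projections. [folklore] -/
theorem sub_eq_one_sub_mul_of_nested {P P' : Matrix n n ℂ} (h₁ : P' * P = P') :
    P - P' = (1 - P') * P := by
  rw [Matrix.sub_mul, Matrix.one_mul, h₁]

/-- An orthogonal projection has norm `≤ 1` (restated from `LTQOFrustrationFreeProofs` for
`1 − P`). [folklore] -/
theorem norm_one_sub_le_one {P : Matrix n n ℂ} (hP : P.IsHermitian) (hP2 : P * P = P) :
    ‖(1 : Matrix n n ℂ) - P‖ ≤ 1 :=
  norm_le_one_of_isHermitian_of_isIdempotentElem (isHermitian_one_sub hP) (one_sub_mul_one_sub hP2)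

end Projections

/-! ### The block decomposition `Y = (1 − P) Y (1 − P) + P Y P` -/

section Blocks

variable {n : Type*} [Fintype n] [DecidableEq n]

/-- **Block decomposition of a commuting observable.** If `P` is idempotent and `[Y, P] = 0` then
`Y = (1 − P) Y (1 − P) + P Y P` (the off-diagonal blocks `P Y (1 − P) = Y P (1 − P) = 0`
vanish). MZ13 §5.2, proof of Lemma 4: "using `[X_u, P₀] = 0`, we have `X̃_u = W_u + Δ_u`, where
`Δ_u = P₀ X̃_u P₀`" (arXiv:1109.1588 p. 13). [cite: MichalakisZwolakCMP2013, §5 Lemma 4 (arXiv:1109.1588 p. 13)] -/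
theorem eq_sandwich_add_sandwich_of_commute {Y P : Matrix n n ℂ} (hP2 : P * P = P)
    (hc : Commute Y P) : Y = (1 - P) * Y * (1 - P) + P * Y * P := by
  have h1 : P * Y * (1 - P) = 0 := by
    rw [← hc.eq, Matrix.mul_assoc, isIdempotentElem_iff_mul_one_sub_self.mp hP2, Matrix.mul_zero]
  have h2 : (1 - P) * Y * P = 0 := by
    rw [Matrix.mul_assoc, hc.eq, ← Matrix.mul_assoc,
      isIdempotentElem_iff_one_sub_mul_self.mp hP2, Matrix.zero_mul]
  have h3 : Y = ((1 - P) + P) * Y * ((1 - P) + P) := by simp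
  conv_lhs => rw [h3]
  rw [Matrix.add_mul, Matrix.add_mul, Matrix.mul_add, Matrix.mul_add, h1, h2]
  abel

omit [DecidableEq n] in
/-- With `[Y, P] = 0`: `Y P = P Y P`. [folklore] -/
theorem mul_eq_sandwich_of_commute {Y P : Matrix n n ℂ} (hP2 : P * P = P) (hc : Commute Y P) :
    Y * P = P * Y * P := by
  rw [Matrix.mul_assoc, hc.eq, ← Matrix.mul_assoc, hP2]

/-- **`‖O P‖ ≤ ‖P Y P‖ + ‖Y − O‖`** for `[Y, P] = 0` and `P` an orthogonal projection: the part
of `Y` inside the range of `P` is `P Y P` (`= Δ_u` in MZ13), and `O` differs from `Y` by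
`‖Y − O‖`. This is the step "`‖Σ_{r ≤ ℓ} X̃_u(r) P₀‖ ≤ ‖W_u P₀‖ + ‖Σ_{r > ℓ} X̃_u(r) P₀‖ + ‖Δ_u‖`"
of MZ13 Lemma 4 (arXiv:1109.1588 p. 13, display (bound1)).
[cite: MichalakisZwolakCMP2013, §5 Lemma 4 (arXiv:1109.1588 p. 13)] -/
theorem norm_mul_proj_le_of_commute {Y O P : Matrix n n ℂ} (hP : P.IsHermitian)
    (hP2 : P * P = P) (hc : Commute Y P) : ‖O * P‖ ≤ ‖P * Y * P‖ + ‖Y - O‖ := by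
  have h1 : O * P = P * Y * P - (Y - O) * P := by
    rw [← mul_eq_sandwich_of_commute hP2 hc, Matrix.sub_mul, sub_sub_cancel]
  rw [h1]
  calc ‖P * Y * P - (Y - O) * P‖ ≤ ‖P * Y * P‖ + ‖(Y - O) * P‖ := norm_sub_le _ _
    _ ≤ ‖P * Y * P‖ + ‖Y - O‖ * ‖P‖ := by gcongr; exact l2_opNorm_mul _ _
    _ ≤ ‖P * Y * P‖ + ‖Y - O‖ * 1 := by
        gcongr
        exact norm_le_one_of_isHermitian_of_isIdempotentElem hP hP2
    _ = ‖P * Y * P‖ + ‖Y - O‖ := by rw [mul_one]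

end Blocks

/-! ### The telescoping pieces `S_{j+1} − S_j` -/

section Telescope

variable {n : Type*} [Fintype n] [DecidableEq n]

omit [Fintype n] [DecidableEq n] in
/-- Telescoping: `S 0 + Σ_{j<N} (S (j+1) − S j) = S N`. [folklore] -/
theorem add_sum_range_sub_eq (S : ℕ → Matrix n n ℂ) (N : ℕ) :
    S 0 + ∑ j ∈ range N, (S (j + 1) - S j) = S N := by
  rw [Finset.sum_range_sub, add_sub_cancel]

/-- **The sandwich `S = (1 − P) Y (1 − P)` is annihilated by `P`** on the right. [folklore] -/
theorem sandwich_mul_proj_eq_zero {Y P : Matrix n n ℂ} (hP2 : P * P = P) :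
    (1 - P) * Y * (1 - P) * P = 0 := by
  rw [Matrix.mul_assoc, isIdempotentElem_iff_one_sub_mul_self.mp hP2, Matrix.mul_zero]

/-- The sandwich `S = (1 − P) Y (1 − P)` is annihilated by `P` on the left. [folklore] -/
theorem proj_mul_sandwich_eq_zero {Y P : Matrix n n ℂ} (hP2 : P * P = P) :
    P * ((1 - P) * Y * (1 - P)) = 0 := by
  rw [← Matrix.mul_assoc, ← Matrix.mul_assoc, isIdempotentElem_iff_mul_one_sub_self.mp hP2,
    Matrix.zero_mul, Matrix.zero_mul]

/-- For nested projections `P' P = P'` (`P'` below `P`), the sandwich by `1 − P` is also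
annihilated by `P'` on the right: `(1 − P) Y (1 − P) P' = 0`. [folklore] -/
theorem sandwich_mul_proj_eq_zero_of_nested {Y P P' : Matrix n n ℂ} (hP : P.IsHermitian)
    (hP' : P'.IsHermitian) (h : P' * P = P') : (1 - P) * Y * (1 - P) * P' = 0 := by
  rw [Matrix.mul_assoc, one_sub_mul_eq_zero_of_mul_eq (mul_eq_of_mul_eq_of_isHermitian hP hP' h),
    Matrix.mul_zero]

/-- For nested projections `P' P = P'`, `P' (1 − P) Y (1 − P) = 0`. [folklore] -/
theorem proj_mul_sandwich_eq_zero_of_nested {Y P P' : Matrix n n ℂ} (h : P' * P = P') :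
    P' * ((1 - P) * Y * (1 - P)) = 0 := by
  rw [← Matrix.mul_assoc, ← Matrix.mul_assoc, mul_one_sub_eq_zero_of_mul_eq h, Matrix.zero_mul,
    Matrix.zero_mul]

/-- **The telescoping piece is locally block-off-diagonal (right).** For nested orthogonal
projections `P' P = P'` (`P = P_j`, `P' = P_{j+1}`), the piece
`(1 − P') Y (1 − P') − (1 − P) Y (1 − P)` is annihilated by `P'` on the right. This is the
property "`Y_u(j) P_{b_j(u)} = 0`" of the pieces in MZ13 Lemma 4 (arXiv:1109.1588 p. 13), for the
telescoping variant. [cite: MichalakisZwolakCMP2013, §5 Lemma 4 (arXiv:1109.1588 p. 13)] -/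
theorem piece_mul_proj_eq_zero {Y P P' : Matrix n n ℂ} (hP : P.IsHermitian) (hP' : P'.IsHermitian)
    (hP'2 : P' * P' = P') (h : P' * P = P') :
    ((1 - P') * Y * (1 - P') - (1 - P) * Y * (1 - P)) * P' = 0 := by
  rw [Matrix.sub_mul, sandwich_mul_proj_eq_zero hP'2,
    sandwich_mul_proj_eq_zero_of_nested hP hP' h, sub_self]

/-- **The telescoping piece is locally block-off-diagonal (left).**
[cite: MichalakisZwolakCMP2013, §5 Lemma 4 (arXiv:1109.1588 p. 13)] -/
theorem proj_mul_piece_eq_zero {Y P P' : Matrix n n ℂ} (hP'2 : P' * P' = P') (h : P' * P = P') :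
    P' * ((1 - P') * Y * (1 - P') - (1 - P) * Y * (1 - P)) = 0 := by
  rw [Matrix.mul_sub, proj_mul_sandwich_eq_zero hP'2, proj_mul_sandwich_eq_zero_of_nested h,
    sub_self]

/-- **The piece in terms of the layer `E = P − P'`:**
`(1 − P') Y (1 − P') − (1 − P) Y (1 − P) = E Y (1 − P') + (1 − P) Y E`. [folklore] -/
theorem piece_eq_layer {Y P P' : Matrix n n ℂ} :
    (1 - P') * Y * (1 - P') - (1 - P) * Y * (1 - P) =
      (P - P') * Y * (1 - P') + (1 - P) * Y * (P - P') := by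
  have h1 : (1 : Matrix n n ℂ) - P' = (1 - P) + (P - P') := by abel
  rw [h1]
  simp only [Matrix.add_mul, Matrix.mul_add]
  abel

/-- The L²-operator norm is invariant under the adjoint; for Hermitian `A`, `B`:
`‖A B‖ = ‖B A‖`. [folklore] -/
theorem norm_mul_comm_of_isHermitian {A B : Matrix n n ℂ} (hA : A.IsHermitian)
    (hB : B.IsHermitian) : ‖A * B‖ = ‖B * A‖ := by
  rw [← l2_opNorm_conjTranspose (A * B), conjTranspose_mul, hA.eq, hB.eq]

/-- **Norm of a telescoping piece:** for Hermitian `Y` and orthogonal projections `P`, `P'`,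
`‖(1 − P') Y (1 − P') − (1 − P) Y (1 − P)‖ ≤ 2‖(P − P') Y‖`. [folklore] -/
theorem norm_piece_le {Y P P' : Matrix n n ℂ} (hY : Y.IsHermitian) (hP : P.IsHermitian)
    (hP2 : P * P = P) (hP' : P'.IsHermitian) (hP'2 : P' * P' = P') :
    ‖(1 - P') * Y * (1 - P') - (1 - P) * Y * (1 - P)‖ ≤ 2 * ‖(P - P') * Y‖ := by
  have hE : (P - P').IsHermitian := hP.sub hP'
  rw [piece_eq_layer]
  calc ‖(P - P') * Y * (1 - P') + (1 - P) * Y * (P - P')‖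
      ≤ ‖(P - P') * Y * (1 - P')‖ + ‖(1 - P) * Y * (P - P')‖ := norm_add_le _ _
    _ ≤ ‖(P - P') * Y‖ * ‖(1 : Matrix n n ℂ) - P'‖ + ‖(1 : Matrix n n ℂ) - P‖ * ‖Y * (P - P')‖ := by
        gcongr
        · exact l2_opNorm_mul _ _
        · rw [Matrix.mul_assoc]; exact l2_opNorm_mul _ _
    _ ≤ ‖(P - P') * Y‖ * 1 + 1 * ‖Y * (P - P')‖ := by
        gcongr
        · exact norm_one_sub_le_one hP' hP'2
        · exact norm_one_sub_le_one hP hP2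
    _ = 2 * ‖(P - P') * Y‖ := by
        rw [norm_mul_comm_of_isHermitian hY hE]; ring

/-- **The layer estimate:** for nested orthogonal projections `P' P = P'` and any `O`,
`‖(P − P') Y‖ ≤ ‖O P‖ + ‖Y − O‖` when `O`, `P` are Hermitian
(`P − P' = (1 − P') P`, `‖1 − P'‖ ≤ 1`, `‖P O‖ = ‖O P‖`, `‖P − P'‖ ≤ 1`). In MZ13 Lemma 4,
`O = Σ_{q ≤ ℓ} X̃_u(q)` is the part of `X̃_u` supported deep inside the ball of `P = P_{b_u(j)}`
(arXiv:1109.1588 p. 13: "`‖E_p Σ_{q ≤ p/2} X̃_u(q)‖ ≤ ‖P_{b_u(p−1)} Σ_{q ≤ p/2} X̃_u(q)‖`").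
[cite: MichalakisZwolakCMP2013, §5 Lemma 4 (arXiv:1109.1588 p. 13)] -/
theorem norm_layer_mul_le {Y O P P' : Matrix n n ℂ} (hO : O.IsHermitian) (hP : P.IsHermitian)
    (hP2 : P * P = P) (hP' : P'.IsHermitian) (hP'2 : P' * P' = P') (hn : P' * P = P') :
    ‖(P - P') * Y‖ ≤ ‖O * P‖ + ‖Y - O‖ := by
  have hPP' : P * P' = P' := mul_eq_of_mul_eq_of_isHermitian hP hP' hn
  have hE : (P - P') * (P - P') = P - P' := sub_mul_sub_of_nested hP2 hP'2 hn hPP'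
  have hEh : (P - P').IsHermitian := hP.sub hP'
  have hE1 : ‖P - P'‖ ≤ 1 := norm_le_one_of_isHermitian_of_isIdempotentElem hEh hE
  have hsplit : (P - P') * Y = (P - P') * O + (P - P') * (Y - O) := by
    rw [Matrix.mul_sub, add_sub_cancel]
  rw [hsplit]
  calc ‖(P - P') * O + (P - P') * (Y - O)‖
      ≤ ‖(P - P') * O‖ + ‖(P - P') * (Y - O)‖ := norm_add_le _ _
    _ ≤ ‖(1 - P') * (P * O)‖ + ‖P - P'‖ * ‖Y - O‖ := by
        rw [sub_eq_one_sub_mul_of_nested hn, Matrix.mul_assoc]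
        gcongr
        exact l2_opNorm_mul _ _
    _ ≤ ‖(1 : Matrix n n ℂ) - P'‖ * ‖P * O‖ + 1 * ‖Y - O‖ := by
        gcongr
        exact l2_opNorm_mul _ _
    _ ≤ 1 * ‖P * O‖ + 1 * ‖Y - O‖ := by
        gcongr
        exact norm_one_sub_le_one hP' hP'2
    _ = ‖O * P‖ + ‖Y - O‖ := by rw [one_mul, one_mul, norm_mul_comm_of_isHermitian hP hO]

end Telescope

end Literature.MathematicalPhysics.QuantumLattice
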